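import Summits.AtomisticToContinuum.HydrodynamicLimit.Theorems.TwoClocksTransferEntropyClockEquilibriumFamilyBaire
import Summits.AtomisticToContinuum.HydrodynamicLimit.Theses.TwoClocks
import HarnessLib

/-!
# Equilibrium family node from the pointwise kinetic node, layer 4: the registered stub `stub_equilibriumFamily`

Crux `Summit.AtomisticToContinuum.HydrodynamicLimit.Theses.TwoClocks.TransferEntropyClock` (stmt-AtomisticToContinuum-16625),
line `Sketch`, registered stub S3a `stub_equilibriumFamily : EquilibriumFamilyUpgrade`
(`= WindowUpgrade → TwoClocks.KineticWindowLDUniform → EquilibriumKineticLDFamily`): THE POINTWISE KINETIC DOCKING NODE IS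
SECRETLY FAMILY-UNIFORM AT GLOBAL EQUILIBRIUM — along one-parameter families of CONSTANT profiles `(a(s), θ(s), u(s))` and
x-independent weights at one fixed reduced density `σ`, the window-LD bound holds with a tilt radius `β₀` and, per `(β, ε)`,
thresholds `τ₀, N₀` UNIFORM in the family parameter. Proof files (lead prover-line-stmt-AtomisticToContinuum-16625-0):
`…EquilibriumFamilyFrame` (this chain's layer 1: exact frame reduction + Gaussian tail statics), `…EquilibriumFamilyStatics`
(layer 2: the property `Good`, midpoint convexity, closed radius super-level sets), `…EquilibriumFamilyBaire` (layer 3: the Banach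
space of admissible profiles, the Baire uniform-radius theorem, orthogonality transfer), `…EquilibriumFamily` (layer 4: the stub).

THIS FILE. The registered statements (verbatim from the line skeleton `Cruxes/TransferEntropyClock/Lines/Sketch.lean` v3, this file's
namespace) and the proof of `stub_equilibriumFamily`: Step 1 — at `(σ, Φ)` every admissible profile has a positive tilt radius
(`KineticWindowLDUniform` at the unit frame `(a, θ, u) = (1, 1, 0)`, guard `σ³ ≤ η₀`, plus the window upgrade `WindowUpgrade`, stub
S3x), hence ONE radius constant `c` by `uniform_good_of_pointwise`; Step 2 — along the family on `[0, t₁]`, the unit-frame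
functionals `Ψt s w = F_s(√θ(s) w + u(s))` are `R(1+‖w‖²)`-bounded with profiles in `admissible` (`ortho_frame`) of norm `≤ R`, and
the family moments ARE the unit-frame moments at window `√θ(s) τ` (`vMoment_frame`); Step 3 — `β₀ := min (c/4R) (1/64R)`: at tilt `2β`
every profile of the family is `Good`; for fixed `(β, ε)` the thresholds are made uniform in `s` by compactness of `[0, t₁]`
(continuity of `θ`, uniform continuity of `Ψt` on `[0,t₁] × B̄(0,L)` with `L` a Gaussian tail radius, the local estimate
`local_window_bound`, a finite subcover). No open hypothesis: the only non-landed input is the registered stub S3x (landing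
alongside as `Theorems/TwoClocksTransferEntropyClockWindowUpgrade.lean`), consumed here as the HYPOTHESIS `WindowUpgrade` of the
stub's own signature.
-/

noncomputable section

open MeasureTheory Filter Set Topology Function
open scoped ENNReal
open Literature.MathematicalPhysics.KineticTheory Literature.Analysis.FluidPDE
open Summit.AtomisticToContinuum.HydrodynamicLimit.Theorems.KineticWindowGronwallBoost
open Summit.AtomisticToContinuum.HydrodynamicLimit.Theorems.KineticWindowGronwallThermalScaling
open Summit.AtomisticToContinuum.HydrodynamicLimit.Theorems.KineticWindowGronwallFrame
open Summit.AtomisticToContinuum.HydrodynamicLimit.Theorems.KineticWindowGronwallNegative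

namespace Summit.AtomisticToContinuum.HydrodynamicLimit.Theorems.TransferEntropyClockFrame

/-! ## The registered statements (verbatim from the line skeleton `Cruxes/TransferEntropyClock/Lines/Sketch.lean` v3) -/

section Statements

open Summit.AtomisticToContinuum.HydrodynamicLimit.Theses

/-- **Stub statement S3x (provable) — WINDOW UPGRADE at equilibrium for a general fast functional.** Under the
constant-profile (global canonical, flow-invariant) Gibbs law, a window-LD bound holding at ONE window per `(β, ε)`
(the `∃ τ` shape of `KineticWindowLDUniform` / crux 2) holds at EVERY long window with ONE threshold in `N` (strong shape
`∃ τ₀ ∃ N₀ ∀ τ ≥ τ₀ ∀ N ≥ N₀`, which is what the Baire step needs: windows in a compact range at a common `N₀`), on a possibly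
smaller tilt range: Hölder + invariance (`lintegral_exp_window_nat_mul_le`, `lintegral_exp_window_add_le_geomMean`,
landed) and the a-priori Gaussian bound at every window (`kineticCurrentsWindowLD_apriori`, landed); verbatim the
argument of the landed `equilibriumShearWindowLD_iff_allWindows` for a general continuous `F` of quadratic growth. -/
def WindowUpgrade : Prop :=
  ∀ (σ a₀ θ₀ : ℝ) (u₀ : V3), 0 < σ → σ ≤ 1 / 2 → 0 < a₀ → 0 < θ₀ →
    ∀ (Φ : (N : ℕ) → HardSphereFlow (Torus.geometry (Fin 3)) (hsDiameter σ N) (N + 1))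
      (F : T3 × V3 → ℝ), Continuous F → (∃ C : ℝ, ∀ y, |F y| ≤ C * (1 + ‖y.2‖ ^ 2)) →
    ∀ β₀ : ℝ, 0 < β₀ →
    (∀ β : ℝ, |β| ≤ β₀ → ∀ ε : ℝ, 0 < ε → ∃ τ : ℝ, 0 < τ ∧ ∃ N₀ : ℕ, ∀ N : ℕ, N₀ ≤ N →
      ∫⁻ z, ENNReal.ofReal (Real.exp (β * ∑ i : Fin (N + 1),
          (τ * ((N : ℝ) + 1) ^ (-(1 / 3 : ℝ)))⁻¹ *
            ∫ r in (0 : ℝ)..(τ * ((N : ℝ) + 1) ^ (-(1 / 3 : ℝ))), F (((Φ N).flow r z) i)))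
        ∂(localGibbsLaw σ (fun _ => a₀) (fun _ => u₀) (fun _ => θ₀) N (Φ N)) ≤
        ENNReal.ofReal (Real.exp (ε * ((N : ℝ) + 1)))) →
    ∃ β₁ : ℝ, 0 < β₁ ∧ ∀ β : ℝ, |β| ≤ β₁ → ∀ ε : ℝ, 0 < ε → ∃ τ₀ : ℝ, 0 < τ₀ ∧ ∃ N₀ : ℕ,
      ∀ τ : ℝ, τ₀ ≤ τ → ∀ N : ℕ, N₀ ≤ N →
      ∫⁻ z, ENNReal.ofReal (Real.exp (β * ∑ i : Fin (N + 1),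
          (τ * ((N : ℝ) + 1) ^ (-(1 / 3 : ℝ)))⁻¹ *
            ∫ r in (0 : ℝ)..(τ * ((N : ℝ) + 1) ^ (-(1 / 3 : ℝ))), F (((Φ N).flow r z) i)))
        ∂(localGibbsLaw σ (fun _ => a₀) (fun _ => u₀) (fun _ => θ₀) N (Φ N)) ≤
        ENNReal.ofReal (Real.exp (ε * ((N : ℝ) + 1)))

/-- **Intermediate node (the provable half of the kinetic UNIFORMITY upgrade) — `EquilibriumKineticLDFamily`.** The
heart's family-uniform kinetic node `KineticCurrentsWindowLDFamily` RESTRICTED to x-CONSTANT data: one-parameter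
families `s ↦ (a(s), θ(s), u(s))` of CONSTANT profiles (global equilibria at one fixed `σ`) and x-independent weights
`(A(s), b(s), G(s, ·))`, thresholds `β₀, τ₀, N₀` uniform in `s ∈ [0, t₁]` (innermost), windows `∀ τ ≥ τ₀`. Claimed
PROVABLE from the pointwise `KineticWindowLDUniform` (S3a): Baire uniform tilt radius on weighted-sup-norm bounded sets
at the unit frame (`TransferEntropyClockBaire.uniform_radius_of_baire`), exact activity / boost / thermal-scaling
covariance of hard-sphere flows and homogeneous Gibbs laws (landed, route AntiMazurCoboundaries), window upgrade (S3x),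
truncation + Hölder + static one-site control (landed, crux 14440 line), compactness in `s`. -/
def EquilibriumKineticLDFamily : Prop :=
  ∃ η₀ : ℝ, 0 < η₀ ∧ ∀ (t₁ : ℝ) (a θ₀ : ℝ → ℝ) (u₀ : ℝ → V3),
    Continuous a → Continuous θ₀ → Continuous u₀ → (∀ s, 0 < a s) → (∀ s, 0 < θ₀ s) →
    ∀ σ : ℝ, 0 < σ → σ ^ 3 ≤ η₀ →
    ∀ Φ : (N : ℕ) → HardSphereFlow (Torus.geometry (Fin 3)) (hsDiameter σ N) (N + 1),
    ∀ (A : ℝ → Fin 3 → Fin 3 → ℝ) (b : ℝ → V3) (G : ℝ → ℝ → ℝ),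
    Continuous A → Continuous b → Continuous (Function.uncurry G) →
    (let F := fun (s : ℝ) (y : T3 × V3) =>
       (∑ j : Fin 3, ∑ k : Fin 3, A s j k * ((y.2 - u₀ s) j * (y.2 - u₀ s) k)) +
         (∑ j : Fin 3, b s j * (y.2 - u₀ s) j) * G s (‖y.2 - u₀ s‖ ^ 2)
     (∃ C : ℝ, ∀ s ∈ Set.Icc 0 t₁, ∀ y : T3 × V3, |F s y| ≤ C * (1 + ‖y.2‖ ^ 2)) →
     (∀ s ∈ Set.Icc 0 t₁, ∀ x : T3, ∫ v, F s (x, v) * localMaxwellian 1 (θ₀ s) (u₀ s) v = 0) →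
     (∀ s ∈ Set.Icc 0 t₁, ∀ (x : T3) (j : Fin 3),
        ∫ v, F s (x, v) * v j * localMaxwellian 1 (θ₀ s) (u₀ s) v = 0) →
     (∀ s ∈ Set.Icc 0 t₁, ∀ x : T3, ∫ v, F s (x, v) * ‖v‖ ^ 2 * localMaxwellian 1 (θ₀ s) (u₀ s) v = 0) →
     ∃ β₀ : ℝ, 0 < β₀ ∧ ∀ β : ℝ, |β| ≤ β₀ → ∀ ε : ℝ, 0 < ε → ∃ τ₀ : ℝ, 0 < τ₀ ∧ ∀ τ : ℝ, τ₀ ≤ τ →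
     ∃ N₀ : ℕ, ∀ N : ℕ, N₀ ≤ N → ∀ s ∈ Set.Icc 0 t₁,
       ∫⁻ z, ENNReal.ofReal (Real.exp (β * ∑ i : Fin (N + 1),
           (τ * ((N : ℝ) + 1) ^ (-(1 / 3 : ℝ)))⁻¹ *
             ∫ r in (0 : ℝ)..(τ * ((N : ℝ) + 1) ^ (-(1 / 3 : ℝ))), F s ((Φ N).flow r z i)))
         ∂(localGibbsLaw σ (fun _ => a s) (fun _ => u₀ s) (fun _ => θ₀ s) N (Φ N)) ≤
       ENNReal.ofReal (Real.exp (ε * ((N : ℝ) + 1))))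

/-- **Stub statement S3a (provable, L) — the equilibrium family node from the pointwise kinetic node.** -/
def EquilibriumFamilyUpgrade : Prop :=
  WindowUpgrade → TwoClocks.KineticWindowLDUniform → EquilibriumKineticLDFamily

end Statements

/-! ## The assembly: `stub_equilibriumFamily` -/

section Assembly

open Summit.AtomisticToContinuum.HydrodynamicLimit.Theses

/-- **S3a `stub_equilibriumFamily` — the equilibrium family node from the pointwise kinetic node.** [folklore] -/
theorem stub_equilibriumFamily : EquilibriumFamilyUpgrade := by
  intro hWU hKW
  obtain ⟨ηK, hηK, HK⟩ := hKW
  refine ⟨min ηK (1 / 16), lt_min hηK (by norm_num), ?_⟩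
  intro t₁ a θ₀ u₀ ha hθ hu ha0 hθ0 σ hσ hσg Φ A b G hA hb hG F hFC h1 hvj hvv
  have hσK : σ ^ 3 ≤ ηK := hσg.trans (min_le_left _ _)
  have hσh : σ < 2⁻¹ := lt_half_of_cube_le (hσg.trans (min_le_right _ _))
  have hσ2 : σ ≤ 1 / 2 := by rw [one_div]; exact hσh.le
  /- Step 1: at `(σ, Φ)` every admissible profile has a positive tilt radius (KWLDU at the unit frame + the window
  upgrade), hence ONE radius constant `c` by Baire. -/
  have HP : ∀ f : BoundedContinuousFunction V3 ℝ, f ∈ admissible →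
      ∃ r : ℝ, 0 < r ∧ ∀ t : ℝ, |t| < r → Good σ Φ (t • f) := by
    intro f hf
    obtain ⟨hf1, hfv, hfvv⟩ := (mem_admissible_iff f).1 hf
    have hguard : σ ^ 3 * (⨆ x : T3, (fun _ : T3 => (1 : ℝ)) x) ≤ ηK * ∫ x : T3, (fun _ : T3 => (1 : ℝ)) x := by
      simp only [ciSup_const, integral_const, smul_eq_mul, probReal_univ, mul_one]
      exact hσK
    have hgrowth : ∃ C : ℝ, ∀ y : T3 × V3, |(fun y : T3 × V3 => (1 + ‖y.2‖ ^ 2) * f y.2) y| ≤ C * (1 + ‖y.2‖ ^ 2) := by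
      refine ⟨‖f‖, fun y => ?_⟩
      have hw : 0 ≤ 1 + ‖y.2‖ ^ 2 := by positivity
      have hfy : |f y.2| ≤ ‖f‖ := by simpa [Real.norm_eq_abs] using f.norm_coe_le_norm y.2
      simp only [abs_mul, abs_of_nonneg hw]
      nlinarith
    obtain ⟨β₀, hβ₀, hK'⟩ := HK (fun _ => (1 : ℝ)) (fun _ => (1 : ℝ)) (fun _ => (0 : V3)) continuous_const
      continuous_const continuous_const (fun _ => one_pos) (fun _ => one_pos) σ hσ hguard Φ
      (fun y : T3 × V3 => (1 + ‖y.2‖ ^ 2) * f y.2) (continuous_weight_mul f) hgrowth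
      (fun _ => hf1) (fun _ j => hfv j) (fun _ => hfvv)
    obtain ⟨β₁, hβ₁, hU⟩ := hWU σ 1 1 0 hσ hσ2 one_pos one_pos Φ (fun y : T3 × V3 => (1 + ‖y.2‖ ^ 2) * f y.2)
      (continuous_weight_mul f) hgrowth β₀ hβ₀ hK'
    refine ⟨β₁, hβ₁, fun t ht ε hε => ?_⟩
    obtain ⟨τ₀, hτ₀, N₀, hh⟩ := hU t ht.le ε hε
    refine ⟨τ₀, hτ₀, N₀, fun τ hτ N hN => ?_⟩
    rw [vMoment_weight_smul]
    unfold vMoment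
    exact hh τ hτ N hN
  obtain ⟨c, hc, HB⟩ := uniform_good_of_pointwise σ Φ HP
  /- Step 2: bounds along the family on `[0, t₁]`, the unit-frame functionals `Ψt s` and their profiles. -/
  obtain ⟨C', hC'⟩ := hFC
  set C : ℝ := max C' 0 with hCdef
  have hC0 : 0 ≤ C := le_max_right _ _
  have hC : ∀ s ∈ Set.Icc (0 : ℝ) t₁, ∀ y : T3 × V3, |F s y| ≤ C * (1 + ‖y.2‖ ^ 2) := fun s hs y =>
    (hC' s hs y).trans (mul_le_mul_of_nonneg_right (le_max_left _ _) (by positivity))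
  obtain ⟨U, hUb⟩ : ∃ U : ℝ, ∀ s ∈ Set.Icc (0 : ℝ) t₁, ‖u₀ s‖ ≤ U := by
    obtain ⟨U, hU⟩ := isCompact_Icc.exists_bound_of_continuousOn (hu.continuousOn (s := Set.Icc (0 : ℝ) t₁))
    exact ⟨U, hU⟩
  obtain ⟨Θ, hΘb⟩ : ∃ Θ : ℝ, ∀ s ∈ Set.Icc (0 : ℝ) t₁, θ₀ s ≤ Θ := by
    obtain ⟨Θ, hΘ⟩ := isCompact_Icc.exists_bound_of_continuousOn (hθ.continuousOn (s := Set.Icc (0 : ℝ) t₁))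
    exact ⟨Θ, fun s hs => (le_abs_self _).trans (by simpa [Real.norm_eq_abs] using hΘ s hs)⟩
  have hΘ0 : ∀ s ∈ Set.Icc (0 : ℝ) t₁, 0 ≤ Θ := fun s hs => (hθ0 s).le.trans (hΘb s hs)
  set R : ℝ := C * (1 + 2 * U ^ 2 + 2 * |Θ|) + 1 with hRdef
  have hR1 : 1 ≤ R := by
    have : 0 ≤ C * (1 + 2 * U ^ 2 + 2 * |Θ|) := by positivity
    linarith
  have hR0 : 0 < R := by linarith
  -- the unit-frame functional of the family
  set Ψt : ℝ → V3 → ℝ := fun s w => F s ((0 : T3), Real.sqrt (θ₀ s) • w + u₀ s) with hΨt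
  have hΨc : Continuous (Function.uncurry Ψt) := by
    have hG' : Continuous fun p : ℝ × ℝ => G p.1 p.2 := hG
    simp only [hΨt, Function.uncurry_def]
    -- `F s (0, q) = Σ A s j k (q - u₀ s)_j (q - u₀ s)_k + (Σ b s j (q - u₀ s)_j) G s ‖q - u₀ s‖²`, `q = √θ₀(s) w + u₀ s`
    show Continuous fun p : ℝ × V3 => F p.1 ((0 : T3), Real.sqrt (θ₀ p.1) • p.2 + u₀ p.1)
    have hq : Continuous fun p : ℝ × V3 => Real.sqrt (θ₀ p.1) • p.2 + u₀ p.1 - u₀ p.1 := by fun_prop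
    have hcoord : ∀ j : Fin 3, Continuous fun p : ℝ × V3 => (Real.sqrt (θ₀ p.1) • p.2 + u₀ p.1 - u₀ p.1) j :=
      fun j => (EuclideanSpace.proj j).continuous.comp hq
    have hAjk : ∀ j k : Fin 3, Continuous fun p : ℝ × V3 => A p.1 j k := fun j k =>
      ((continuous_apply k).comp ((continuous_apply j).comp hA)).comp continuous_fst
    have hbj : ∀ j : Fin 3, Continuous fun p : ℝ × V3 => b p.1 j := fun j =>
      (EuclideanSpace.proj j).continuous.comp (hb.comp continuous_fst)
    have hGc : Continuous fun p : ℝ × V3 => G p.1 (‖Real.sqrt (θ₀ p.1) • p.2 + u₀ p.1 - u₀ p.1‖ ^ 2) :=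
      hG'.comp (continuous_fst.prodMk ((hq.norm).pow 2))
    refine Continuous.add ?_ ?_
    · exact continuous_finsetSum _ fun j _ => continuous_finsetSum _ fun k _ =>
        (hAjk j k).mul ((hcoord j).mul (hcoord k))
    · exact (continuous_finsetSum _ fun j _ => (hbj j).mul (hcoord j)).mul hGc
  have hΨb : ∀ s ∈ Set.Icc (0 : ℝ) t₁, ∀ w : V3, |Ψt s w| ≤ R * (1 + ‖w‖ ^ 2) := by
    intro s hs w
    have h := hC s hs ((0 : T3), Real.sqrt (θ₀ s) • w + u₀ s)
    have hθs : 0 ≤ θ₀ s := (hθ0 s).le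
    have hq : ‖Real.sqrt (θ₀ s) • w + u₀ s‖ ^ 2 ≤ 2 * (θ₀ s) * ‖w‖ ^ 2 + 2 * U ^ 2 := by
      have h1 : ‖Real.sqrt (θ₀ s) • w + u₀ s‖ ≤ ‖Real.sqrt (θ₀ s) • w‖ + ‖u₀ s‖ := norm_add_le _ _
      have h2 : ‖Real.sqrt (θ₀ s) • w‖ ^ 2 = θ₀ s * ‖w‖ ^ 2 := norm_sqrt_smul_sq hθs w
      have h3 : ‖u₀ s‖ ≤ U := hUb s hs
      nlinarith [norm_nonneg (Real.sqrt (θ₀ s) • w), norm_nonneg (u₀ s), sq_nonneg (‖Real.sqrt (θ₀ s) • w‖ - ‖u₀ s‖),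
        norm_nonneg (Real.sqrt (θ₀ s) • w + u₀ s)]
    have hΘs : θ₀ s ≤ |Θ| := (hΘb s hs).trans (le_abs_self _)
    show |F s ((0 : T3), Real.sqrt (θ₀ s) • w + u₀ s)| ≤ R * (1 + ‖w‖ ^ 2)
    refine h.trans ?_
    have hw : 0 ≤ ‖w‖ ^ 2 := sq_nonneg _
    calc C * (1 + ‖Real.sqrt (θ₀ s) • w + u₀ s‖ ^ 2) ≤ C * (1 + (2 * (θ₀ s) * ‖w‖ ^ 2 + 2 * U ^ 2)) := by gcongr
      _ ≤ C * (1 + 2 * U ^ 2 + 2 * |Θ|) * (1 + ‖w‖ ^ 2) := by nlinarith [mul_nonneg hC0 hw, mul_nonneg (mul_nonneg hC0 hw) (abs_nonneg Θ)]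
      _ ≤ R * (1 + ‖w‖ ^ 2) := by
          have : C * (1 + 2 * U ^ 2 + 2 * |Θ|) ≤ R := by rw [hRdef]; linarith
          exact mul_le_mul_of_nonneg_right this (by positivity)
  -- profiles of the family functionals
  have hprof : ∀ s ∈ Set.Icc (0 : ℝ) t₁, ∃ f : BoundedContinuousFunction V3 ℝ,
      f ∈ admissible ∧ ‖f‖ ≤ R ∧ ∀ w : V3, (1 + ‖w‖ ^ 2) * f w = Ψt s w := by
    intro s hs
    have hcs : Continuous (Ψt s) := hΨc.comp (Continuous.prodMk_right s)
    have hfc : Continuous fun w : V3 => Ψt s w / (1 + ‖w‖ ^ 2) := by fun_prop (disch := intro w; positivity)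
    have hfb : ∀ w : V3, ‖Ψt s w / (1 + ‖w‖ ^ 2)‖ ≤ R := by
      intro w
      have hw : 0 < 1 + ‖w‖ ^ 2 := by positivity
      rw [Real.norm_eq_abs, abs_div, abs_of_pos hw, div_le_iff₀ hw]
      exact hΨb s hs w
    set f := BoundedContinuousFunction.ofNormedAddCommGroup _ hfc R hfb with hfdef
    have hfw : ∀ w : V3, (1 + ‖w‖ ^ 2) * f w = Ψt s w := by
      intro w
      have hw : (1 + ‖w‖ ^ 2) ≠ 0 := by positivity
      rw [hfdef, BoundedContinuousFunction.coe_ofNormedAddCommGroup]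
      field_simp
    refine ⟨f, ?_, BoundedContinuousFunction.norm_ofNormedAddCommGroup_le hfc hR0.le hfb, hfw⟩
    -- admissibility: transfer the orthogonality of `F s (0, ·)` under `M_{1,u,θ}` to the unit frame
    have hFv : Continuous fun v : V3 => F s ((0 : T3), v) := by
      have h := hΨc.comp (Continuous.prodMk_right s)
      -- `v ↦ F s (0, v)` is `Ψt s` precomposed with the inverse affine map
      have hrt : Real.sqrt (θ₀ s) ≠ 0 := (Real.sqrt_pos.2 (hθ0 s)).ne'
      have he : (fun v : V3 => F s ((0 : T3), v)) =
          (Ψt s) ∘ fun v : V3 => (Real.sqrt (θ₀ s))⁻¹ • (v - u₀ s) := by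
        funext v
        simp only [Function.comp_apply, hΨt, smul_smul, mul_inv_cancel₀ hrt, one_smul, sub_add_cancel]
      rw [he]
      exact h.comp (by fun_prop)
    have hCs : ∀ v : V3, |F s ((0 : T3), v)| ≤ C * (1 + ‖v‖ ^ 2) := fun v => hC s hs ((0 : T3), v)
    obtain ⟨o1, ov, ovv⟩ := ortho_frame (hθ0 s) (u₀ s) hFv hCs (h1 s hs 0) (fun j => hvj s hs 0 j) (hvv s hs 0)
    rw [mem_admissible_iff]
    refine ⟨?_, fun j => ?_, ?_⟩
    · simpa only [hfw] using o1
    · simpa only [hfw] using ov j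
    · simpa only [hfw] using ovv
  -- the frame reduction of the family moments
  have hred : ∀ s : ℝ, ∀ (N : ℕ) (β τ : ℝ), 0 ≤ τ →
      ∫⁻ z, ENNReal.ofReal (Real.exp (β * ∑ i : Fin (N + 1),
          (τ * ((N : ℝ) + 1) ^ (-(1 / 3 : ℝ)))⁻¹ *
            ∫ r in (0 : ℝ)..(τ * ((N : ℝ) + 1) ^ (-(1 / 3 : ℝ))), F s ((Φ N).flow r z i)))
        ∂(localGibbsLaw σ (fun _ => a s) (fun _ => u₀ s) (fun _ => θ₀ s) N (Φ N)) =
      vMoment σ 1 1 0 N (Φ N) (Ψt s) β (Real.sqrt (θ₀ s) * τ) := by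
    intro s N β τ hτ
    have hφc : Continuous fun w : V3 => F s ((0 : T3), w + u₀ s) := by
      have h := hΨc.comp (Continuous.prodMk_right s)
      have hrt : Real.sqrt (θ₀ s) ≠ 0 := (Real.sqrt_pos.2 (hθ0 s)).ne'
      have he : (fun w : V3 => F s ((0 : T3), w + u₀ s)) = (Ψt s) ∘ fun w : V3 => (Real.sqrt (θ₀ s))⁻¹ • w := by
        funext w
        simp only [Function.comp_apply, hΨt, smul_smul, mul_inv_cancel₀ hrt, one_smul]
      rw [he]
      exact h.comp (continuous_const_smul _)
    have hfr := vMoment_frame hσ hσh (ha0 s) (hθ0 s) (u₀ s) N (Φ N) hφc β hτ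
    have hL : vMoment σ (a s) (θ₀ s) (u₀ s) N (Φ N) (fun v => (fun w : V3 => F s ((0 : T3), w + u₀ s)) (v - u₀ s)) β τ =
        ∫⁻ z, ENNReal.ofReal (Real.exp (β * ∑ i : Fin (N + 1),
          (τ * ((N : ℝ) + 1) ^ (-(1 / 3 : ℝ)))⁻¹ *
            ∫ r in (0 : ℝ)..(τ * ((N : ℝ) + 1) ^ (-(1 / 3 : ℝ))), F s ((Φ N).flow r z i)))
        ∂(localGibbsLaw σ (fun _ => a s) (fun _ => u₀ s) (fun _ => θ₀ s) N (Φ N)) := by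
      unfold vMoment
      simp only [sub_add_cancel]
      rfl
    rw [← hL, hfr]
  /- Step 3: the family-uniform tilt radius and, for fixed `(β, ε)`, thresholds uniform in `s` by compactness.
  From here on the definitions of `F` and `Ψt` are no longer unfolded. -/
  clear_value Ψt F
  refine ⟨min (c / (4 * R)) (1 / (64 * R)), by positivity, fun β hβ ε hε => ?_⟩
  have hβc : |β| ≤ c / (4 * R) := hβ.trans (min_le_left _ _)
  have hβR : |β| ≤ 1 / (64 * R) := hβ.trans (min_le_right _ _)
  -- tilt `2β` on a profile of norm `≤ R` stays inside the uniform radius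
  have h2β : ∀ f : BoundedContinuousFunction V3 ℝ, f ∈ admissible → ‖f‖ ≤ R → Good σ Φ ((2 * β) • f) := by
    intro f hf hfR
    refine HB f hf (2 * β) ?_
    have h1 : |2 * β| * ‖f‖ ≤ 2 * (c / (4 * R)) * R := by
      rw [abs_mul, abs_two]
      exact mul_le_mul (by linarith) hfR (norm_nonneg _) (by positivity)
    have h2 : 2 * (c / (4 * R)) * R = c / 2 := by field_simp; ring
    linarith
  -- the tail level `4 |β| R ≤ 1/16`, the tail radius `L`, the continuity modulus `δ'`
  have hK0 : 0 ≤ 4 * |β| * R := by positivity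
  have hK8' : 4 * |β| * R ≤ 1 / 8 := by
    have : 4 * |β| * R ≤ 4 * (1 / (64 * R)) * R := by gcongr
    have h2 : 4 * (1 / (64 * R)) * R = 1 / 16 := by field_simp; ring
    linarith
  obtain ⟨L, hL⟩ := exists_tail_le hK0 hK8' (by positivity : (0 : ℝ) < ε / 4)
  set δ' : ℝ := min 1 ε / (128 * (|β| + 1)) with hδ'def
  have hδ'0 : 0 < δ' := by positivity
  have hδ'1 : 2 * |β| * δ' ≤ 1 / 8 := by
    rw [hδ'def]
    have hm : min 1 ε ≤ 1 := min_le_left _ _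
    have : 2 * |β| * (min 1 ε / (128 * (|β| + 1))) = (|β| / (|β| + 1)) * (min 1 ε / 64) := by field_simp; ring
    rw [this]
    have hq : |β| / (|β| + 1) ≤ 1 := (div_le_one (by positivity)).2 (by linarith)
    have hq0 : 0 ≤ |β| / (|β| + 1) := by positivity
    nlinarith [lt_min one_pos hε]
  have hδ'2 : 13 * (2 * |β| * δ') ≤ ε / 4 := by
    rw [hδ'def]
    have hm : min 1 ε ≤ ε := min_le_right _ _
    have : 13 * (2 * |β| * (min 1 ε / (128 * (|β| + 1)))) = (|β| / (|β| + 1)) * (26 / 128) * min 1 ε := by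
      field_simp; ring
    rw [this]
    have hq : |β| / (|β| + 1) ≤ 1 := (div_le_one (by positivity)).2 (by linarith)
    have hq0 : 0 ≤ |β| / (|β| + 1) := by positivity
    nlinarith [lt_min one_pos hε]
  -- uniform continuity of `Ψt` on `[0, t₁] × B̄(0, L)`
  have hUC : ∃ ρ : ℝ, 0 < ρ ∧ ∀ s ∈ Set.Icc (0 : ℝ) t₁, ∀ s' ∈ Set.Icc (0 : ℝ) t₁, ∀ w : V3, ‖w‖ ≤ L →
      dist s s' < ρ → |Ψt s w - Ψt s' w| < δ' := by
    have hKc : IsCompact (Set.Icc (0 : ℝ) t₁ ×ˢ Metric.closedBall (0 : V3) L) :=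
      isCompact_Icc.prod (isCompact_closedBall _ _)
    have hU := hKc.uniformContinuousOn_of_continuous hΨc.continuousOn
    rw [Metric.uniformContinuousOn_iff] at hU
    obtain ⟨ρ, hρ, hU⟩ := hU δ' hδ'0
    refine ⟨ρ, hρ, fun s hs s' hs' w hw hd => ?_⟩
    have hw' : w ∈ Metric.closedBall (0 : V3) L := by rwa [Metric.mem_closedBall, dist_zero_right]
    have h := hU (s, w) ⟨hs, hw'⟩ (s', w) ⟨hs', hw'⟩ (by
      rw [Prod.dist_eq, dist_self, max_eq_left dist_nonneg]; exact hd)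
    rwa [Function.uncurry_apply_pair, Function.uncurry_apply_pair, Real.dist_eq] at h
  obtain ⟨ρ₂, hρ₂, hnear⟩ := hUC
  -- the local claim around each `s₀ ∈ [0, t₁]`
  have hloc : ∀ s₀ ∈ Set.Icc (0 : ℝ) t₁, ∃ ρ : ℝ, 0 < ρ ∧ ∃ τl : ℝ, 0 < τl ∧ ∃ Nl : ℕ,
      ∀ s ∈ Set.Icc (0 : ℝ) t₁, dist s s₀ < ρ → ∀ τ : ℝ, τl ≤ τ → ∀ N : ℕ, Nl ≤ N →
        vMoment σ 1 1 0 N (Φ N) (Ψt s) β (Real.sqrt (θ₀ s) * τ) ≤ ENNReal.ofReal (Real.exp (ε * ((N : ℝ) + 1))) := by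
    intro s₀ hs₀
    obtain ⟨f₀, hf₀, hf₀R, hf₀w⟩ := hprof s₀ hs₀
    obtain ⟨τ₀, hτ₀, N₀, hgood⟩ := h2β f₀ hf₀ hf₀R ε hε
    have hθh : 0 < θ₀ s₀ / 2 := half_pos (hθ0 s₀)
    obtain ⟨ρ₁, hρ₁, hθnear⟩ : ∃ ρ₁ : ℝ, 0 < ρ₁ ∧ ∀ s : ℝ, dist s s₀ < ρ₁ → θ₀ s₀ / 2 < θ₀ s := by
      obtain ⟨ρ₁, hρ₁, h⟩ := Metric.continuousAt_iff.1 hθ.continuousAt (θ₀ s₀ / 2) hθh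
      refine ⟨ρ₁, hρ₁, fun s hs => ?_⟩
      have h' := h hs
      rw [Real.dist_eq, abs_lt] at h'
      linarith
    set rt : ℝ := Real.sqrt (θ₀ s₀ / 2) with hrtdef
    have hrt : 0 < rt := Real.sqrt_pos.2 hθh
    refine ⟨min ρ₁ ρ₂, lt_min hρ₁ hρ₂, τ₀ / rt, div_pos hτ₀ hrt, N₀, fun s hs hds τ hτ N hN => ?_⟩
    have hθs : θ₀ s₀ / 2 < θ₀ s := hθnear s (hds.trans_le (min_le_left _ _))
    have hds₂ : dist s s₀ < ρ₂ := hds.trans_le (min_le_right _ _)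
    have hτ0 : 0 ≤ τ := (div_pos hτ₀ hrt).le.trans hτ
    set τ' : ℝ := Real.sqrt (θ₀ s) * τ with hτ'def
    have hrs : rt ≤ Real.sqrt (θ₀ s) := Real.sqrt_le_sqrt hθs.le
    have hwin : τ₀ ≤ τ' := by
      rw [hτ'def]
      have h1 : τ₀ ≤ rt * τ := by rw [div_le_iff₀ hrt] at hτ; linarith
      exact h1.trans (mul_le_mul_of_nonneg_right hrs hτ0)
    have hτ'0 : 0 < τ' := hτ₀.trans_le hwin
    -- the isolated Hölder + tail estimate
    have hA := hgood τ' hwin N hN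
    rw [vMoment_weight_smul] at hA
    have eΨ : (fun w : V3 => (1 + ‖w‖ ^ 2) * f₀ w) = Ψt s₀ := funext fun w => hf₀w w
    rw [eΨ] at hA
    have hfar : ∀ w : V3, |Ψt s w - Ψt s₀ w| ≤ 2 * R * (1 + ‖w‖ ^ 2) := by
      intro w
      have h1 : |Ψt s w| ≤ R * (1 + ‖w‖ ^ 2) := hΨb s hs w
      have h2 : |Ψt s₀ w| ≤ R * (1 + ‖w‖ ^ 2) := hΨb s₀ hs₀ w
      have h4 : |Ψt s w - Ψt s₀ w| ≤ |Ψt s w| + |Ψt s₀ w| := abs_sub _ _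
      linarith
    exact local_window_bound hσ2 N (Φ N) (hΨc.comp (Continuous.prodMk_right s))
      (hΨc.comp (Continuous.prodMk_right s₀)) hτ'0 hε hδ'0 hδ'1 hδ'2
      (fun w hw => (hnear s hs s₀ hs₀ w hw hds₂).le) hfar hL hA
  -- compactness of `[0, t₁]`
  choose! ρf hρf τf hτf Nf hP using hloc
  obtain ⟨t, htI, hcov⟩ := isCompact_Icc.elim_nhds_subcover (fun s₀ => Metric.ball s₀ (ρf s₀))
    (fun s₀ hs₀ => Metric.ball_mem_nhds _ (hρf s₀ hs₀))
  have hsum0 : 0 ≤ ∑ x ∈ t, τf x := Finset.sum_nonneg fun x hx => (hτf x (htI x hx)).le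
  refine ⟨1 + ∑ x ∈ t, τf x, by linarith, fun τ hτ => ⟨∑ x ∈ t, Nf x, fun N hN s hs => ?_⟩⟩
  have hτ0 : 0 ≤ τ := by linarith
  obtain ⟨x, hx, hsx⟩ : ∃ x ∈ t, s ∈ Metric.ball x (ρf x) := by
    simpa only [Set.mem_iUnion, exists_prop] using hcov hs
  have hxI : x ∈ Set.Icc (0 : ℝ) t₁ := htI x hx
  have hτx : τf x ≤ τ := by
    have h1 : τf x ≤ ∑ y ∈ t, τf y := Finset.single_le_sum (fun y hy => (hτf y (htI y hy)).le) hx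
    linarith
  have hNx : Nf x ≤ N := (Finset.single_le_sum (fun y _ => Nat.zero_le (Nf y)) hx).trans hN
  rw [hred s N β τ hτ0]
  exact hP x hxI s hs (Metric.mem_ball.1 hsx) τ hτx N hNx

end Assembly

end Summit.AtomisticToContinuum.HydrodynamicLimit.Theorems.TransferEntropyClockFrame

end
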